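import Literature.MathematicalPhysics.QuantumLattice.XYOrderThermalInfraredProofs
import HarnessLib

/-!
# Kennedy–Lieb–Shastry / Dyson–Lieb–Simon: long-range order in the quantum XY model at positive temperature, all spins, `d ≥ 3`

Trunk T-QLATTICE; sibling proof file of `XYOrder.lean` (item
`provefact-Literature.MathematicalPhysics.QuantumLattice.kennedy_lieb_shastry_xy_thermal`). No
statement and no definition is introduced or changed. This file **discharges the named fact
`kennedy_lieb_shastry_xy_thermal`** (`kennedy_lieb_shastry_xy_thermal_holds`): for every `d ≥ 3`
and every spin `S = n/2 ≥ ½` there is `β₀` such that for `β ≥ β₀` the Gibbs states of the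
ferromagnetic quantum XY model on the even tori `(ℤ/2kℤ)^d` have long-range order,
`liminf_k (2k)^{-2d} Σ_{x,y} Re⟨S¹_xS¹_y + S²_xS²_y⟩_β > 0`.

The source result: Dyson–Lieb–Simon prove this for `S = ½` ([DLS1978] Thm. 5.2: "The spin 1/2
x-y model with nearest neighbor interactions on a simple cubic lattice in `ν ≥ 3` dimensions
possesses a phase transition at sufficiently low temperatures", via the abstract criterion
Thm. 5.1 fed by Gaussian domination Thm. 4.2, the infrared bound (44) and the transfer
Thms. 3.1–3.2); with the improvements of Kennedy–Lieb–Shastry ([KLS1988PRL] eqs. (3)–(8): the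
sum rule weighted by `cos pᵢ`, Kubo's inequality `|e₃| ≤ e₁`, the variational bound `e₁ ≥ ½S²`
and the lattice integral `I(d) ≤ I(2) < 1/√2 · 2S`) the same method covers every spin — "in
these papers and in [DLS] it is proved that the XY model has long range order … in 3 dimensions
at positive temperature for all `S ≥ 1/2`" (E. H. Lieb, *Statistical Mechanics, Selecta*,
commentary to papers IV.3, IV.7, IV.8).

## The proof (finite even tori, KLS arrangement at `T > 0`)

All model-dependent inputs are theorems of the sibling files, for every spin `n/2`:
(GDᵀ) `partitionFn_xyField_le` (`XYOrderThermalGDProofs`), (Aᵀ) `xy_infraredBound_thermal`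
(`XYOrderThermalInfraredProofs`), (Bᵀ) `xy_kubo_thermal`, (Cᵀ) `sum_xy_structureFactor_mul_torusCosSum`,
(Dᵀ) `xy_pairCorr_lower_thermal`, (Sᵀ) `gibbsState_xy_corr_one_eq_zero`, (Tᵀ)
`abs_re_gibbsState_xy_corr_le` (`XYOrderThermalBoundsProofs`). This file supplies the
model-independent assembly:

* `kls_thermal_ineq7` — [KLS1988PRL] eq. (7) at positive temperature on the dual torus, for an
  abstract structure factor `g`: (Aᵀ)+(Bᵀ)+(Cᵀ) give
  `e₁ ≤ |Λ|⁻¹g₀ + ½√e₁ R_L + T_L/(2β)` with `R_L` the punctured Riemann sum of the KLS integrand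
  (`klsRiemannSum`) and `T_L = |Λ|⁻¹Σ_{p≠0}E_p⁻¹` (`torusGreen 0`);
* `kls_thermal_margin` — the analytic endgame for abstract sequences: with
  `limsup R_L ≤ ρ < 1/√2` (`klsRiemannSum_eventually_le`), `T_L → c_d < ∞` for `d ≥ 3`
  (`torusGreen_tendsto_latticeGreen`), `s = ½S²`, `ℓ = log(n+1)/(2d)`, the monotone step
  `t ↦ t - ½R√t` and `β₀ = 16ℓ + 1 + 4(ℓ + 𝒯/2)/c`, `c = 2(s - ½√s ρ) > 0`, every sequence
  `a_k = 2g_k ≤ 2S²` with `e_k ≤ g_k + ½√e_k R_{2k} + T_{2k}/(2β)` and `e_k ≥ s - ℓ/β` eventually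
  has `liminf a ≥ c/2 > 0` for `β ≥ β₀`;
* `kennedy_lieb_shastry_xy_thermal_holds` — the instantiation: `a_k` is the LRO sequence of
  `XYOrder.lean` (`= 2|Λ|⁻¹ĝ¹₀` by (Sᵀ), bounded by (Tᵀ)), `e_k = e₁`, `g_k = |Λ|⁻¹ĝ¹₀`.

## References

* [DLS1978] F. J. Dyson, E. H. Lieb, B. Simon, *Phase transitions in quantum spin systems with
  isotropic and nonisotropic interactions*, J. Stat. Phys. 18 (1978) 335–383, Thms. 3.1–3.2,
  4.2, 5.1, 5.2 (read in: E. H. Lieb, *Statistical Mechanics (Selecta)*, paper IV.3,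
  pp. 160–169, and the editors'/author's commentary, p. ix).
* [KLS1988PRL] T. Kennedy, E. H. Lieb, B. S. Shastry, *The XY model has long-range order for all
  spins and all dimensions greater than one*, Phys. Rev. Lett. 61 (1988) 2582–2584, eqs. (3)–(8)
  (Selecta paper IV.8, pp. 327–329).
* [Kubo1988PRL] K. Kubo, Phys. Rev. Lett. 61 (1988) 110 (positive temperature, `S ≥ 1`, `d = 3`).
-/

noncomputable section

open Filter Topology Matrix Finset
open Literature.MathematicalPhysics.QuantumLattice Literature.Probability.LatticeModels
  Literature.Probability.Percolation Literature.MathematicalPhysics.QuantumLattice.XYOrderProofs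
  Literature.Barriers.AtomisticToContinuum.BoseGas
open scoped BigOperators

namespace Literature.MathematicalPhysics.QuantumLattice

variable {d : ℕ}

/-! ### [KLS1988PRL] eq. (7) at positive temperature, for an abstract structure factor -/

section Ineq7

/-- The pointwise step (Aᵀ)+(Bᵀ) ⇒ integrand of [KLS1988PRL] (8) plus the thermal term: if
`0 ≤ g ≤ b₀ + ½[(d e₁ - e₃ C)/E]^{1/2}`, `|e₃| ≤ e₁`, `E, d > 0`, `b₀ ≥ 0`, then
`g (C/d) ≤ {C/d}₊ b₀ + ½ e₁^{1/2} [((d + C)/E)^{1/2} {C/d}₊]`. [cite: KLS1988PRL, eqs. (5), (7), (8)]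
[cite: DysonLiebSimon1978, Thm. 5.1] -/
theorem kls_thermal_pointwise {g E C dd e₁ e₃ b₀ : ℝ} (hg : 0 ≤ g) (hE : 0 < E) (hdd : 0 < dd)
    (hb₀ : 0 ≤ b₀) (hA : g ≤ b₀ + 1 / 2 * Real.sqrt ((dd * e₁ - e₃ * C) / E))
    (hB : |e₃| ≤ e₁) :
    g * (C / dd) ≤ max (C / dd) 0 * b₀ +
      1 / 2 * Real.sqrt e₁ * (Real.sqrt ((dd + C) / E) * max (C / dd) 0) := by
  have he₁ : 0 ≤ e₁ := (abs_nonneg _).trans hB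
  rcases le_or_gt C 0 with hC | hC
  · calc g * (C / dd) ≤ 0 :=
          mul_nonpos_of_nonneg_of_nonpos hg (div_nonpos_of_nonpos_of_nonneg hC hdd.le)
      _ ≤ _ := by positivity
  · have hCd : 0 ≤ C / dd := by positivity
    rw [max_eq_left hCd]
    -- the radicand is at most `e₁ (d + C)/E`
    have hrad : (dd * e₁ - e₃ * C) / E ≤ e₁ * ((dd + C) / E) := by
      rw [mul_div_assoc', div_le_div_iff_of_pos_right hE]
      have h3 : -e₃ * C ≤ e₁ * C := mul_le_mul_of_nonneg_right ((neg_le_abs e₃).trans hB) hC.le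
      nlinarith
    have hsq : Real.sqrt ((dd * e₁ - e₃ * C) / E) ≤ Real.sqrt e₁ * Real.sqrt ((dd + C) / E) := by
      rw [← Real.sqrt_mul he₁]
      exact Real.sqrt_le_sqrt hrad
    calc g * (C / dd) ≤ (b₀ + 1 / 2 * Real.sqrt ((dd * e₁ - e₃ * C) / E)) * (C / dd) :=
          mul_le_mul_of_nonneg_right hA hCd
      _ ≤ (b₀ + 1 / 2 * (Real.sqrt e₁ * Real.sqrt ((dd + C) / E))) * (C / dd) := by gcongr
      _ = _ := by ring

/-- **[KLS1988PRL] eq. (7) at positive temperature, on the dual torus.** Let `g` be a function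
on the dual torus of side `L` (the thermal structure factor), `e₁, e₃` reals and `β > 0` with
(Aᵀ) `0 ≤ g_q ≤ 1/(2βE_q) + ½[Σᵢ(e₁ - e₃cos qᵢ)/E_q]^{1/2}` for `q ≠ 0`, (Bᵀ) `|e₃| ≤ e₁` and the
sum rule (Cᵀ) `|Λ|⁻¹Σ_q g_q (d⁻¹Σᵢcos qᵢ) = e₁`. Then
`e₁ ≤ |Λ|⁻¹g₀ + ½√e₁ R_L + T_L/(2β)` with `R_L = klsRiemannSum d L` and `T_L = torusGreen 0`.
[cite: KLS1988PRL, eq. (7)] [cite: DysonLiebSimon1978, Thm. 5.1] -/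
theorem kls_thermal_ineq7 (hd : 1 ≤ d) (L : ℕ) [NeZero L] {β e₁ e₃ : ℝ} (hβ : 0 < β)
    (g : TorusSite d L → ℝ)
    (hA : ∀ q : TorusSite d L, q ≠ 0 → 0 ≤ g q ∧
      g q ≤ 1 / (2 * β * dispersion (latticeMomentum L q)) +
        1 / 2 * Real.sqrt ((∑ i, (e₁ - e₃ * Real.cos (latticeMomentum L q i))) /
          dispersion (latticeMomentum L q)))
    (hB : |e₃| ≤ e₁)
    (hC : (∑ q : TorusSite d L, g q * (torusCosSum L q / d)) / (L : ℝ) ^ d = e₁) :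
    e₁ ≤ g 0 / (L : ℝ) ^ d + 1 / 2 * Real.sqrt e₁ * klsRiemannSum d L +
      1 / (2 * β) * torusGreen (0 : TorusSite d L) := by
  have hd0 : (0 : ℝ) < d := by exact_mod_cast (show 0 < d by omega)
  have hL : (0 : ℝ) < (L : ℝ) ^ d := by
    have : (0 : ℝ) < L := by exact_mod_cast Nat.pos_of_ne_zero (NeZero.ne L)
    positivity
  have hsum : ∑ q : TorusSite d L, g q * (torusCosSum L q / d) ≤
      g 0 + (1 / 2 * Real.sqrt e₁ *
          ∑ q ∈ (univ : Finset (TorusSite d L)).erase 0, klsIntegrand d (latticeMomentum L q) +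
        1 / (2 * β) * ∑ q ∈ (univ : Finset (TorusSite d L)).erase 0,
            1 / dispersion (latticeMomentum L q)) := by
    rw [← add_sum_erase _ _ (mem_univ (0 : TorusSite d L)), torusCosSum_zero,
      div_self hd0.ne', mul_one, mul_sum, mul_sum, ← sum_add_distrib]
    refine add_le_add le_rfl (sum_le_sum fun q hq => ?_)
    have hq0 : q ≠ 0 := (mem_erase.1 hq).1
    have hE := dispersion_latticeMomentum_pos (d := d) hq0
    obtain ⟨hg, hAq⟩ := hA q hq0
    rw [sum_const_sub_mul_cos_latticeMomentum] at hAq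
    have hb₀ : 0 ≤ 1 / (2 * β * dispersion (latticeMomentum L q)) := by positivity
    have hpt := kls_thermal_pointwise hg hE hd0 hb₀ hAq hB
    rw [klsIntegrand_latticeMomentum]
    have hmax : max (torusCosSum L q / d) 0 ≤ 1 :=
      max_le ((div_le_one hd0).2 (torusCosSum_le _ _)) zero_le_one
    have hterm : max (torusCosSum L q / d) 0 *
        (1 / (2 * β * dispersion (latticeMomentum L q))) ≤
        1 / (2 * β) * (1 / dispersion (latticeMomentum L q)) := by
      calc max (torusCosSum L q / d) 0 * (1 / (2 * β * dispersion (latticeMomentum L q)))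
          ≤ 1 * (1 / (2 * β * dispersion (latticeMomentum L q))) :=
            mul_le_mul_of_nonneg_right hmax hb₀
        _ = 1 / (2 * β) * (1 / dispersion (latticeMomentum L q)) := by
            rw [one_mul, one_div_mul_one_div]
    linarith
  rw [klsRiemannSum_of_neZero, torusGreen_zero_eq]
  calc e₁ = (∑ q : TorusSite d L, g q * (torusCosSum L q / d)) / (L : ℝ) ^ d := hC.symm
    _ ≤ (g 0 + (1 / 2 * Real.sqrt e₁ *
          ∑ q ∈ (univ : Finset (TorusSite d L)).erase 0, klsIntegrand d (latticeMomentum L q) +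
        1 / (2 * β) * ∑ q ∈ (univ : Finset (TorusSite d L)).erase 0,
            1 / dispersion (latticeMomentum L q))) / (L : ℝ) ^ d :=
        div_le_div_of_nonneg_right hsum hL.le
    _ = _ := by rw [add_div, add_div, mul_div_assoc, mul_div_assoc, add_assoc]

end Ineq7

/-! ### The analytic endgame, for abstract sequences -/

section Margin

/-- **The margin at low temperature** ([KLS1988PRL], end of the paragraph after eq. (8), at
`T > 0`; [DLS1978] Thm. 5.1, (49)–(51)). Fix `d ≥ 3` and a spin `n/2 ≥ ½`; let `ρ < 1/√2` bound
the KLS Riemann sums eventually (`klsRiemannSum_eventually_le`) and `𝒯` bound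
`T_L = torusGreen 0` eventually (`d ≥ 3`). There is `β₀ > 0` such that for `β ≥ β₀` every real
sequence `a` with `a_k ≤ 2S²` for all `k` and, eventually in `k`, `a_k = 2g_k`,
`e_k ≤ g_k + ½√e_k R_{2k} + T_{2k}/(2β)` and `e_k ≥ ½S² - log(n+1)/(2dβ)` for some reals `e_k, g_k`,
satisfies `liminf a > 0` (indeed `≥ s - ½√sρ - …`, `s = ½S²`, by the monotonicity of
`t ↦ t - ½R√t` on `√t ≥ R/4`). [cite: KLS1988PRL, Theorem and eqs. (7)–(8)]
[cite: DysonLiebSimon1978, Thm. 5.1] -/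
theorem kls_thermal_margin (hd : 3 ≤ d) {n : ℕ} (hn : 1 ≤ n) :
    ∃ β₀ : ℝ, 0 < β₀ ∧ ∀ β : ℝ, β₀ ≤ β → ∀ a : ℕ → ℝ,
      (∀ k, a k ≤ 2 * ((n : ℝ) / 2) ^ 2) →
      (∀ᶠ k : ℕ in atTop, ∀ [NeZero (2 * k)], ∃ e g : ℝ, a k = 2 * g ∧
          e ≤ g + 1 / 2 * Real.sqrt e * klsRiemannSum d (2 * k) +
            1 / (2 * β) * torusGreen (0 : TorusSite d (2 * k)) ∧
          ((n : ℝ) / 2) ^ 2 / 2 - Real.log ((n : ℝ) + 1) / (2 * d * β) ≤ e) →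
      0 < liminf a atTop := by
  have hd0 : (0 : ℝ) < d := by exact_mod_cast (show 0 < d by omega)
  -- the eventual bound on the KLS Riemann sums
  obtain ⟨ρ, hρlt, hρev⟩ := klsRiemannSum_eventually_le d (by omega)
  set ρ' : ℝ := max ρ 0 with hρ'_def
  have hρ'0 : 0 ≤ ρ' := le_max_right _ _
  have hρ'lt : ρ' < Real.sqrt 2 / 2 := max_lt hρlt (by positivity)
  have h2pos : (0 : ℝ) < Real.sqrt 2 := by positivity
  have h22 : Real.sqrt 2 * Real.sqrt 2 = 2 := Real.mul_self_sqrt (by norm_num)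
  have hsqrt2 : Real.sqrt 2 < 2 := by
    rw [Real.sqrt_lt' (by norm_num)]; norm_num
  -- the spin constant `s = ½ S²` and its root
  set s : ℝ := ((n : ℝ) / 2) ^ 2 / 2 with hs_def
  have hn1 : (1 : ℝ) ≤ n := by exact_mod_cast hn
  have hs8 : 1 / 8 ≤ s := by
    rw [hs_def]
    nlinarith
  have hs0 : 0 ≤ s := by linarith
  have hsq : Real.sqrt s = n * Real.sqrt 2 / 4 := by
    have h2 : s = (n * Real.sqrt 2 / 4) ^ 2 := by
      rw [hs_def, div_pow, div_pow, mul_pow, Real.sq_sqrt (by norm_num : (0 : ℝ) ≤ 2)]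
      ring
    rw [h2, Real.sqrt_sq (by positivity)]
  have hss : Real.sqrt 2 / 4 ≤ Real.sqrt s := by
    rw [hsq]
    nlinarith
  -- the zero-temperature margin `c = 2(s - ½√s ρ') > 0`
  set c : ℝ := 2 * (s - 1 / 2 * Real.sqrt s * ρ') with hc_def
  have hc : 0 < c := by
    have h1 : Real.sqrt s * Real.sqrt s = s := Real.mul_self_sqrt hs0
    have h3 : 0 < Real.sqrt s - ρ' / 2 := by linarith
    have h4 : s - 1 / 2 * Real.sqrt s * ρ' = Real.sqrt s * (Real.sqrt s - ρ' / 2) := by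
      rw [mul_sub, h1]; ring
    rw [hc_def, h4]
    exact mul_pos two_pos (mul_pos (lt_of_lt_of_le (by positivity) hss) h3)
  -- the thermal term `T_L`
  obtain ⟨𝒯, k₀, h𝒯0, h𝒯⟩ := torusGreen_zero_eventually_le (d := d) hd
  -- the entropy constant and the threshold `β₀`
  set ℓ : ℝ := Real.log ((n : ℝ) + 1) / (2 * d) with hℓ_def
  have hℓ0 : 0 ≤ ℓ := by
    rw [hℓ_def]
    exact div_nonneg (Real.log_nonneg (by linarith)) (by positivity)
  set β₀ : ℝ := 16 * ℓ + 1 + 4 * (ℓ + 𝒯 / 2) / c with hβ₀_def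
  have hβ₀pos : 0 < β₀ := by rw [hβ₀_def]; positivity
  refine ⟨β₀, hβ₀pos, fun β hβ a hbd hev => ?_⟩
  have hβpos : 0 < β := hβ₀pos.trans_le hβ
  have hβ16 : 16 * ℓ ≤ β := by
    have : (0 : ℝ) ≤ 4 * (ℓ + 𝒯 / 2) / c := by positivity
    linarith
  have hβc : 4 * (ℓ + 𝒯 / 2) / c ≤ β := by linarith
  -- consequences: `ℓ/β ≤ 1/16` and `ℓ/β + 𝒯/(2β) ≤ c/4`
  have hℓβ : ℓ / β ≤ 1 / 16 := by
    rw [div_le_iff₀ hβpos]; linarith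
  have hτβ : ℓ / β + 𝒯 / (2 * β) ≤ c / 4 := by
    rw [div_add_div _ _ hβpos.ne' (by positivity), div_le_iff₀ (by positivity)]
    rw [div_le_iff₀ hc] at hβc
    nlinarith
  -- eventually `R_{2k} ≤ ρ'`
  have h2k : Tendsto (fun k : ℕ => 2 * k) atTop atTop :=
    tendsto_atTop_atTop.2 fun b => ⟨b, fun k hk => by omega⟩
  have hRk : ∀ᶠ k : ℕ in atTop, klsRiemannSum d (2 * k) ≤ ρ' :=
    (h2k.eventually hρev).mono fun k hk => hk.trans (le_max_left _ _)
  -- eventually the sequence is `≥ c/2`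
  have hev' : ∀ᶠ k : ℕ in atTop, c / 2 ≤ a k := by
    filter_upwards [hRk, hev, eventually_ge_atTop k₀, eventually_ge_atTop 1] with k hk hevk hkk₀ hk1
    haveI : NeZero (2 * k) := ⟨by omega⟩
    obtain ⟨e, g, hag, h7, hDk⟩ := hevk
    set R := klsRiemannSum d (2 * k) with hR_def
    set T := torusGreen (0 : TorusSite d (2 * k)) with hT_def
    have hR0 : 0 ≤ R := klsRiemannSum_nonneg _ _
    have hT0 : 0 ≤ T := torusGreen_zero_nonneg (d := d) (2 * k)
    have hT𝒯 : T ≤ 𝒯 := h𝒯 k hkk₀ hk1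
    -- (Dᵀ): `s - ℓ/β ≤ e`
    have hsℓ : Real.log ((n : ℝ) + 1) / (2 * d * β) = ℓ / β := by
      rw [hℓ_def, div_div]
    rw [hsℓ] at hDk
    have hℓβ0 : 0 ≤ ℓ / β := by positivity
    obtain ⟨sβ, hsβ_def⟩ : ∃ sβ : ℝ, sβ = s - ℓ / β := ⟨_, rfl⟩
    have hsβe : sβ ≤ e := by rw [hsβ_def, hs_def]; exact hDk
    have hsβ16 : 1 / 16 ≤ sβ := by rw [hsβ_def]; linarith
    have hsβ0 : 0 ≤ sβ := by linarith
    have hsβs : sβ ≤ s := by rw [hsβ_def]; linarith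
    -- the monotone step on `t ↦ t - ½ R √t`
    have hR4 : R ≤ 4 * Real.sqrt sβ := by
      have h14 : (1 / 4 : ℝ) ≤ Real.sqrt sβ := by
        rw [Real.le_sqrt (by norm_num) hsβ0]; linarith
      linarith
    have hmono := kls_monotone_step hsβ0 hsβe hR4
    -- `½ R √sβ ≤ ½ √s ρ'`
    have hRs : 1 / 2 * Real.sqrt sβ * R ≤ 1 / 2 * Real.sqrt s * ρ' :=
      mul_le_mul (mul_le_mul_of_nonneg_left (Real.sqrt_le_sqrt hsβs) (by norm_num)) hk hR0
        (by positivity)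
    -- the thermal term
    have hTβ : 1 / (2 * β) * T ≤ 𝒯 / (2 * β) := by
      rw [one_div_mul_eq_div]
      exact div_le_div_of_nonneg_right hT𝒯 (by positivity)
    -- assemble (all linear from here)
    have key : sβ - 1 / 2 * Real.sqrt sβ * R - 1 / (2 * β) * T ≤ g := by
      linarith [h7, hmono]
    rw [hag]
    linarith [key, hRs, hTβ, hτβ, hsβ_def, hc_def]
  exact (half_pos hc).trans_le (le_liminf_of_le (isCoboundedUnder_ge_of_le atTop hbd) hev')

end Margin

/-! ### The thermal XY correlation of `XYOrder.lean` -/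

section Unfold

variable (β : ℝ) (L : ℕ) [NeZero L] (n : ℕ)

/-- Unfolding `xyCorrTorus` on a genuine torus. [cite: KLS1988PRL, Theorem] -/
theorem xyCorrTorus_of_neZero (x y : TorusSite d L) :
    xyCorrTorus (d := d) β L n x y =
      (∑ α : Fin 2, thermalCorr β (xyTorus d L n)
        (siteSpin n x (Fin.castLE (by norm_num) α)) (siteSpin n y (Fin.castLE (by norm_num) α))).re := by
  simp [xyCorrTorus, NeZero.ne L]

/-- The thermal XY correlation is the sum of the `1–1` and `2–2` Gibbs correlations.
[cite: KLS1988PRL, Theorem] -/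
theorem xyCorrTorus_eq_add (x y : TorusSite d L) :
    xyCorrTorus (d := d) β L n x y =
      (gibbsState β (xyTorus d L n) (siteSpin n x 0 * siteSpin n y 0)).re +
        (gibbsState β (xyTorus d L n) (siteSpin n x 1 * siteSpin n y 1)).re := by
  rw [xyCorrTorus_of_neZero, Fin.sum_univ_two, Complex.add_re]
  rfl

end Unfold

/-- Junk side: the thermal XY correlation vanishes on the empty torus `L = 0`. [folklore] -/
@[simp] theorem xyCorrTorus_zero_side (β : ℝ) (n : ℕ) (x y : TorusSite d 0) :
    xyCorrTorus (d := d) β 0 n x y = 0 := by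
  simp [xyCorrTorus]

/-! ### The theorem -/

/-- **Long-range order in the quantum XY model at positive temperature, for all spins and all
`d ≥ 3`** (discharge of `kennedy_lieb_shastry_xy_thermal`): for every `d ≥ 3` and every spin
`S = n/2 ≥ ½` there is `β₀ > 0` such that for all `β ≥ β₀` the Gibbs states of
`H = -Σ_{⟨xy⟩}(S¹_xS¹_y + S²_xS²_y)` on the even tori `(ℤ/2kℤ)^d` satisfy
`liminf_k (2k)^{-2d}Σ_{x,y}Re⟨S¹_xS¹_y + S²_xS²_y⟩_β > 0`. Dyson–Lieb–Simon's theorem (Thm. 5.2,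
`S = ½`) by their method (Thms. 3.1–3.2, 4.2, 5.1) in the Kennedy–Lieb–Shastry arrangement
(eqs. (3)–(8)), which covers every spin; all inputs are theorems of the tree (trust base: Mathlib's
axioms only). [cite: DysonLiebSimon1978, Thms. 4.2, 5.1, 5.2] [cite: KLS1988PRL, Theorem, eqs. (3)–(8)] -/
theorem kennedy_lieb_shastry_xy_thermal_holds : kennedy_lieb_shastry_xy_thermal := by
  intro d hd n hn
  have hd1 : 1 ≤ d := by omega
  have hd0 : (0 : ℝ) < d := by exact_mod_cast (show 0 < d by omega)
  obtain ⟨β₀, hβ₀, hmar⟩ := kls_thermal_margin (d := d) hd hn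
  refine ⟨β₀, hβ₀, fun β hβ => ?_⟩
  have hβpos : 0 < β := hβ₀.trans_le hβ
  rw [hasEvenTorusLRO_iff]
  refine hmar β hβ _ (fun k => ?_) ?_
  · -- boundedness of the LRO sequence, from (Tᵀ)
    refine div_le_of_le_mul₀ (by positivity) (by positivity) ?_
    have hb : ∀ x y : Site d,
        torusPullback (fun L x y => xyCorrTorus (d := d) β L n x y) (2 * k) x y ≤
          2 * ((n : ℝ) / 2) ^ 2 := by
      intro x y
      rw [torusPullback_apply]
      rcases Nat.eq_zero_or_pos k with rfl | hk
      · have h0 : xyCorrTorus (d := d) β (2 * 0) n (Torus.proj (2 * 0) x) (Torus.proj (2 * 0) y) = 0 := by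
          simp [xyCorrTorus]
        rw [h0]
        positivity
      · haveI : NeZero (2 * k) := ⟨by omega⟩
        rw [xyCorrTorus_eq_add]
        have h0 := le_of_abs_le (abs_re_gibbsState_xy_corr_le β (2 * k) n 0
          (Torus.proj (2 * k) x) (Torus.proj (2 * k) y))
        have h1 := le_of_abs_le (abs_re_gibbsState_xy_corr_le β (2 * k) n 1
          (Torus.proj (2 * k) x) (Torus.proj (2 * k) y))
        linarith
    calc ∑ x ∈ halfOpenBox d (2 * k), ∑ y ∈ halfOpenBox d (2 * k),
          torusPullback (fun L x y => xyCorrTorus (d := d) β L n x y) (2 * k) x y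
        ≤ ∑ x ∈ halfOpenBox d (2 * k), ∑ y ∈ halfOpenBox d (2 * k), 2 * ((n : ℝ) / 2) ^ 2 :=
          sum_le_sum fun x _ => sum_le_sum fun y _ => hb x y
      _ = 2 * ((n : ℝ) / 2) ^ 2 * ((halfOpenBox d (2 * k)).card : ℝ) ^ 2 := by
          simp only [sum_const, nsmul_eq_mul]
          ring
  · -- eventually: the physics at side `L = 2k ≥ 4`
    filter_upwards [eventually_ge_atTop 2] with k hk2
    intro inst
    have hL4 : 4 ≤ 2 * k := by omega
    have hL3 : 3 ≤ 2 * k := by omega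
    have hLe : Even (2 * k) := even_two_mul k
    have hdpos : 0 < d := by omega
    have hLpos : (0 : ℝ) < ((2 * k : ℕ) : ℝ) ^ d :=
      pow_pos (by exact_mod_cast (show 0 < 2 * k by omega)) d
    have hNpos : (0 : ℝ) < (d : ℝ) * ((2 * k : ℕ) : ℝ) ^ d := mul_pos hd0 hLpos
    -- the correlation kernel `G^α(x,y) = Re⟨S^α_xS^α_y⟩_β`, abstracted
    obtain ⟨G, hG⟩ : ∃ G : Fin 3 → TorusSite d (2 * k) → TorusSite d (2 * k) → ℝ,
        ∀ α x y, (gibbsState β (xyTorus d (2 * k) n) (siteSpin n x α * siteSpin n y α)).re =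
          G α x y := ⟨fun α x y => _, fun _ _ _ => rfl⟩
    -- the inputs (Aᵀ), (Bᵀ), (Cᵀ), (Dᵀ), (Sᵀ)
    have hA := fun q hq => xy_infraredBound_thermal (d := d) (2 * k) hLe hL4 hdpos n hβpos q hq
    have hB := xy_kubo_thermal (d := d) (2 * k) hLe hL4 n hβpos
    have hC := sum_xy_structureFactor_mul_torusCosSum (d := d) β (2 * k) n 0
    have hD := xy_pairCorr_lower_thermal hd1 (2 * k) hL3 n hβpos
    have hS : ∀ x y, G 1 x y = G 0 x y := fun x y => by
      rw [← hG, ← hG, gibbsState_xy_corr_one_eq_zero]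
    simp only [hG] at hA hB hC hD
    -- names for the pair sums and the structure factor
    set P0 : ℝ := ∑ x : TorusSite d (2 * k), ∑ i : Fin d, G 0 x (x + Pi.single i 1) with hP0
    set P2 : ℝ := ∑ x : TorusSite d (2 * k), ∑ i : Fin d, G 2 x (x + Pi.single i 1) with hP2
    set g : TorusSite d (2 * k) → ℝ := fun q =>
      (∑ x : TorusSite d (2 * k), ∑ y : TorusSite d (2 * k),
        Real.cos (torusPhase (2 * k) q (x - y)) * G 0 x y) / ((2 * k : ℕ) : ℝ) ^ d with hg
    -- eq. (7) at positive temperature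
    have h7 := kls_thermal_ineq7 hd1 (2 * k) hβpos g
      (e₁ := P0 / ((d : ℝ) * ((2 * k : ℕ) : ℝ) ^ d)) (e₃ := P2 / ((d : ℝ) * ((2 * k : ℕ) : ℝ) ^ d))
      (fun q hq => hA q hq) ?_ ?_
    rotate_left
    · -- (Bᵀ) in averaged form
      rw [abs_div, abs_of_pos hNpos]
      exact div_le_div_of_nonneg_right hB hNpos.le
    · -- (Cᵀ) in averaged form
      have h1 : ∑ q : TorusSite d (2 * k), g q * (torusCosSum (2 * k) q / d) =
          (∑ q : TorusSite d (2 * k), (∑ x : TorusSite d (2 * k), ∑ y : TorusSite d (2 * k),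
            Real.cos (torusPhase (2 * k) q (x - y)) * G 0 x y) * torusCosSum (2 * k) q) /
            (((2 * k : ℕ) : ℝ) ^ d * d) := by
        rw [sum_div]
        refine sum_congr rfl fun q _ => ?_
        rw [hg, div_mul_div_comm]
      rw [h1, hC]
      field_simp
    -- the LRO term is `2 |Λ|⁻¹ ĝ₀`
    refine ⟨P0 / ((d : ℝ) * ((2 * k : ℕ) : ℝ) ^ d), g 0 / ((2 * k : ℕ) : ℝ) ^ d, ?_, h7, hD⟩
    rw [XYOrderProofs.sum_halfOpenBox_torusPullback, card_halfOpenBox, hg]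
    simp only [xyCorrTorus_eq_add, hG, hS, ← two_mul, ← mul_sum, torusPhase_zero_left,
      Real.cos_zero, one_mul]
    push_cast
    field_simp

end Literature.MathematicalPhysics.QuantumLattice
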